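import Summits.QuantumFields.YangMills.Theorems.BalabanUVNodesN15CovariantTwoGridStaircasePairing
import Summits.QuantumFields.YangMills.Theorems.BalabanUVNodesN15PerCubeGreenSopLetters
import HarnessLib

/-!
# N15 = NE2, road (c) — PROGRAMME (PC) «[B9] Sect. C FOR THE LANDAU LETTER WITH PER-CUBE GAUGES (3.35) AS PRINTED», (PC-E) (C6-d3) STEP 3: THE STAIRCASE ENTRIES ACROSS THE PAIRING —
# the coarse staircase transport at `πx′` is the fine one at the cell corner `σπx′` (n15-c∕350), within `κ_e2√|m|√|m|·Θ` entrywise of the fine one at `x′` (n15-c∕349, `Θ = (d+1)(d·n′L^mb +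
# (1+ρ)^{L^m} − 1)`), so the entries `Σ_l(δ_{li}δ_{lj} − T′_{li}T′_{lj})` of the cut Gram perturbation `Q₁ᵀQ₁ − Q_TᵀQ_T` read at `(x′, z′)` and at the corners differ by `≤ 2|ι|κΘ`
# (dag-n15-c g32, n15-c∕351)

Cell `pub-ymgap`, seat `pub-ymgap-dag-n15-c` (generation g32; R134 (a) seat, strategy s1 «first missing estimate»; HUMAN RULING D-0062; chair R424 venue).
`bears_on: R4∕N15 · K3⁸ SpineGivenEndpointR13SepCoPHV (stmt-QuantumFields-27366)`; filed `--kind proof --supports stmt-QuantumFields-27366 --as helper` — COUNT-NEUTRAL.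
THEOREMS only ([folklore]), 0 `def`, 0 `sorry`.  Imports BY NAME n15-c∕350 `cvaStair_cvT_lineHol_eq`, n15-c∕349 `norm_holStair_sub_holStair_le`, n15-c∕185a `cvaStair_conj`∕`holStair_unitary`, dag-n15-w2
`uN_abs_coordMat_conj_sub_conj_entry_le_op`, n15-c `abs_cvaStair_cvT_le_one` (`…PerCubeGreenSopLetters`), `kingPr_bpt_hdig`∕`hdig`∕`blockCoords_bpt`∕`bpt_blockCoords`∕`kingBlockOf_bpt`
bookkeeping.  Nothing in the tree is modified, no landed name re-declared.

RESULTS (ns CovAvg).  ★ `cvaStair_kingPr_eq_corner` — under the covariant pairing the coarse transport `T(Γ_{B(πx′),πx′})` of the line-holonomy field is the fine transport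
`T′(Γ′_{B′(x′),⌞x′⌟})` to the cell corner `⌞x′⌟ = σπx′` (block coordinates `L^m·⌊a′∕L^m⌋`); ★ `abs_cvaStair_sub_corner_entry_le` — `|(T′(Γ′_{y,x′}) − T′(Γ′_{y,⌞x′⌟}))_{lj}| ≤ κΘ` from the
letters on the block (n15-c∕349 through `coordMat e Ad`); ★ `abs_gramEntry_sub_le` — `|Σ_l(δδ − A_{li}B_{lj}) − Σ_l(δδ − A′_{li}B′_{lj})| ≤ 2|ι|θ` for entries `≤ 1` and `|A − A′|, |B − B′| ≤ θ`;
★ `abs_gramEntry_le` — `|Σ_l(δ_{li}δ_{lj} − A_{li}B_{lj})| ≤ 1 + |ι|`.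

HONEST FRAMING ∕ LIMITS.  Elementary; MODEL pairing (straight holonomy); nothing of [B7]∕[B9] asserted ((3.19) p.393, (3.57)–(3.60) pp.401–402 = SHAPES).  NE2⁺ NOT PRINTED, NOT proved; N15 of
record untouched (DISCHARGED AS CONSUMED, p687738); K3⁸ OPEN; counts of record UNMOVED (typed 28∕28 · discharged 8∕27); one finite 𝕋⁴ at fixed ε per index — NOT infinite volume, NOT OS on
ℝ⁴, NOT a mass gap, NOT Clay.  Restate-immune (no Theses import).
-/

set_option autoImplicit false

noncomputable section

open scoped BigOperators Matrix Matrix.Norms.L2Operator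
open Finset

namespace Summit.QuantumFields.YangMills.BalabanUVNodes.N15.CovAvg

open Literature.MathematicalPhysics.QuantumFieldTheory.Balaban1983to89
open Literature.MathematicalPhysics.QuantumFieldTheory.Balaban1983to89.B5Prop11Plancherel (Tor fine unitVec)
open Literature.MathematicalPhysics.QuantumFieldTheory.Balaban1983to89.B5Block118 (bpt)
open Literature.MathematicalPhysics.QuantumFieldTheory.King1986.Torus (blockOf)
open Literature.Barriers.QuantumFields (traceForm)
open Summit.QuantumFields.YangMills.BalabanUVNodes.N15.VectorPiece (kingPr blockCoords blockCoords_bpt bpt_blockCoords kingPr_bpt_hdig hdig)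
open Summit.QuantumFields.YangMills.BalabanUVNodes.N15.DefectKernel (kingBlockOf_bpt)
open Summit.QuantumFields.YangMills.BalabanUVNodes.N15.MatrixSpecies (coordMat basisConst basisConst_nonneg)
open Summit.QuantumFields.YangMills.BalabanUVNodes.N15.CurvedSpecies (uN_abs_coordMat_conj_sub_conj_entry_le_op)
open Summit.QuantumFields.YangMills.BalabanUVNodes.N15.Gluing (cvT abs_cvaStair_cvT_le_one)

variable {d : ℕ}

/-! ## §1 Gram entries -/

section Gram

variable {ι : Type} [Fintype ι] [DecidableEq ι]

/-- ★ `|Σ_l(δ_{li}δ_{lj} − A_{li}B_{lj})| ≤ 1 + |ι|` for entries `|A|, |B| ≤ 1`. [folklore] -/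
theorem abs_gramEntry_le {A B : Matrix ι ι ℝ} (hA : ∀ l i, |A l i| ≤ 1) (hB : ∀ l j, |B l j| ≤ 1) (i j : ι) :
    |∑ l, ((1 : Matrix ι ι ℝ) l i * (1 : Matrix ι ι ℝ) l j - A l i * B l j)| ≤ 1 + Fintype.card ι := by
  rw [Finset.sum_sub_distrib]
  refine (abs_sub _ _).trans (add_le_add ?_ ?_)
  · have h11 : ∑ x, (1 : Matrix ι ι ℝ) x i * (1 : Matrix ι ι ℝ) x j = (1 : Matrix ι ι ℝ) i j := by
      calc ∑ x, (1 : Matrix ι ι ℝ) x i * (1 : Matrix ι ι ℝ) x j = ∑ x, (1 : Matrix ι ι ℝ)ᵀ i x * (1 : Matrix ι ι ℝ) x j := by simp only [Matrix.transpose_apply]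
        _ = ((1 : Matrix ι ι ℝ)ᵀ * (1 : Matrix ι ι ℝ)) i j := Matrix.mul_apply.symm
        _ = (1 : Matrix ι ι ℝ) i j := by rw [Matrix.transpose_one, Matrix.one_mul]
    rw [h11, Matrix.one_apply]
    split_ifs <;> simp
  · calc |∑ l, A l i * B l j| ≤ ∑ l, |A l i * B l j| := Finset.abs_sum_le_sum_abs _ _
      _ ≤ ∑ _l : ι, (1 : ℝ) := Finset.sum_le_sum fun l _ => by rw [abs_mul]; exact mul_le_one₀ (hA l i) (abs_nonneg _) (hB l j)
      _ = Fintype.card ι := by rw [Finset.sum_const, Finset.card_univ, nsmul_eq_mul, mul_one]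

/-- ★ `|Σ_l(δδ − A_{li}B_{lj}) − Σ_l(δδ − A′_{li}B′_{lj})| ≤ 2|ι|θ` when `|A|, |B′| ≤ 1` entrywise and `|A − A′|, |B − B′| ≤ θ` entrywise. [folklore] -/
theorem abs_gramEntry_sub_le {A B A' B' : Matrix ι ι ℝ} {θ : ℝ} (hθ : 0 ≤ θ) (hA : ∀ l i, |A l i| ≤ 1) (hB' : ∀ l j, |B' l j| ≤ 1)
    (hAA : ∀ l i, |A l i - A' l i| ≤ θ) (hBB : ∀ l j, |B l j - B' l j| ≤ θ) (i j : ι) :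
    |∑ l, ((1 : Matrix ι ι ℝ) l i * (1 : Matrix ι ι ℝ) l j - A l i * B l j) - ∑ l, ((1 : Matrix ι ι ℝ) l i * (1 : Matrix ι ι ℝ) l j - A' l i * B' l j)| ≤
      2 * Fintype.card ι * θ := by
  rw [← Finset.sum_sub_distrib]
  have hterm : ∀ l, |((1 : Matrix ι ι ℝ) l i * (1 : Matrix ι ι ℝ) l j - A l i * B l j) - ((1 : Matrix ι ι ℝ) l i * (1 : Matrix ι ι ℝ) l j - A' l i * B' l j)| ≤ 2 * θ := by
    intro l
    have e : ((1 : Matrix ι ι ℝ) l i * (1 : Matrix ι ι ℝ) l j - A l i * B l j) - ((1 : Matrix ι ι ℝ) l i * (1 : Matrix ι ι ℝ) l j - A' l i * B' l j) =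
        -(A l i * (B l j - B' l j) + (A l i - A' l i) * B' l j) := by ring
    rw [e, abs_neg]
    refine (abs_add_le _ _).trans ?_
    rw [abs_mul, abs_mul]
    have h1 : |A l i| * |B l j - B' l j| ≤ 1 * θ := mul_le_mul (hA l i) (hBB l j) (abs_nonneg _) zero_le_one
    have h2 : |A l i - A' l i| * |B' l j| ≤ θ * 1 := mul_le_mul (hAA l i) (hB' l j) (abs_nonneg _) hθ
    linarith
  calc _ ≤ ∑ l, |((1 : Matrix ι ι ℝ) l i * (1 : Matrix ι ι ℝ) l j - A l i * B l j) - ((1 : Matrix ι ι ℝ) l i * (1 : Matrix ι ι ℝ) l j - A' l i * B' l j)| := Finset.abs_sum_le_sum_abs _ _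
    _ ≤ ∑ _l : ι, 2 * θ := Finset.sum_le_sum fun l _ => hterm l
    _ = 2 * Fintype.card ι * θ := by rw [Finset.sum_const, Finset.card_univ, nsmul_eq_mul]; ring

end Gram

/-! ## §2 The staircase transports across the pairing -/

section Pair

variable (M : Fin (d + 1) → ℕ) [∀ μ, NeZero (M μ)] (L k m : ℕ) [NeZero L] {mm : Type} [Fintype mm] [DecidableEq mm] {ι : Type} [Fintype ι] [DecidableEq ι]
  (e : Matrix mm mm ℂ ≃L[ℝ] (ι → ℝ))

/-- ★ **THE COARSE TRANSPORT AT `πx′` IS THE FINE TRANSPORT TO THE CELL CORNER**: for the line-holonomy field `U_μ(x) = Π_{t<L^m}U′_μ(σx + te′_μ)` and a fine site `x′` with block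
coordinates `a′`, `T(Γ_{B(πx′),πx′}) = T′(Γ′_{B′(x′),⌞x′⌟})` with `⌞x′⌟` the block point of coordinates `L^m·⌊a′∕L^m⌋` (n15-c∕350 at `c = ⌊a′∕L^m⌋`, King's `π(L^mL^k·y + a′) =
L^k·y + ⌊a′∕L^m⌋`). [cite: King1986, p.664 (pairing convention); Balaban1985Averaging, (124)–(125) p.36 (shape)] -/
theorem cvaStair_kingPr_eq_corner (V' : Fin (d + 1) → Tor (fine (L ^ m * L ^ k) M) → Matrix mm mm ℂ) (x' : Tor (fine (L ^ m * L ^ k) M)) (ν : Fin (d + 1)) :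
    cvaStair M (L ^ k) (fun μ b => cvT e (fun μ x => mprod (fun t => V' μ (kingSec M L k m x + t • unitVec (fine (L ^ m * L ^ k) M) μ)) (L ^ m)) μ b.1)
        (blockOf (L ^ k) M (kingPr L k m M x')) (blockCoords (L ^ k) M (kingPr L k m M x')).2 ν =
      cvaStair M (L ^ m * L ^ k) (fun μ b => cvT e V' μ b.1) (blockOf (L ^ m * L ^ k) M x')
        (fun i => ⟨L ^ m * ((((blockCoords (L ^ m * L ^ k) M x').2 i : Fin (L ^ m * L ^ k)) : ℕ) / L ^ m), (Nat.mul_div_le _ _).trans_lt ((blockCoords (L ^ m * L ^ k) M x').2 i).isLt⟩) ν := by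
  set y := (blockCoords (L ^ m * L ^ k) M x').1 with hy
  set a' := (blockCoords (L ^ m * L ^ k) M x').2 with ha'
  have hx : x' = bpt (L ^ m * L ^ k) M y a' := (bpt_blockCoords (L ^ m * L ^ k) M x').symm
  have hπ : kingPr L k m M x' = bpt (L ^ k) M y (hdig L k m a') := by rw [hx, kingPr_bpt_hdig]
  have hb : blockOf (L ^ k) M (kingPr L k m M x') = y := by rw [hπ, kingBlockOf_bpt]
  have hc : (blockCoords (L ^ k) M (kingPr L k m M x')).2 = hdig L k m a' := by rw [hπ, blockCoords_bpt]
  have hb' : blockOf (L ^ m * L ^ k) M x' = y := by rw [hx, kingBlockOf_bpt]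
  rw [hb, hc, hb']
  exact cvaStair_cvT_lineHol_eq M L k m e V' y (hdig L k m a') ν (fun i => (Nat.mul_div_le _ _).trans_lt (a' i).isLt)

/-- ★ **THE FINE TRANSPORT TO `x′` AGAINST THE ONE TO THE CELL CORNER, ENTRYWISE**: for a unitary fine bond field with `‖U′ − 1‖ ≤ ρ` and the all-direction step letter `b` on the
block of `x′`, `|(T′(Γ′_{y,x′}) − T′(Γ′_{y,⌞x′⌟}))_{lj}| ≤ κ_e2√|m|√|m|·(d+1)(d·n′L^mb + ((1+ρ)^{L^m} − 1))` (n15-c∕349 `norm_holStair_sub_holStair_le` with `K = L^m`, read through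
`coordMat e Ad`). [cite: Balaban1985BackgroundPropagators, (3.57)–(3.58) pp.401–402, (3.73) p.405 (shapes)] -/
theorem abs_cvaStair_sub_corner_entry_le (V' : Fin (d + 1) → Tor (fine (L ^ m * L ^ k) M) → Matrix mm mm ℂ) (hV : ∀ μ z, (V' μ z)ᴴ * V' μ z = 1)
    {ρ b : ℝ} (hρ : 0 ≤ ρ) (hb : 0 ≤ b) (y : Tor M)
    (hρy : ∀ μ z, blockOf (L ^ m * L ^ k) M z = y → ‖V' μ z - 1‖ ≤ ρ)
    (hby : ∀ κ μ z, blockOf (L ^ m * L ^ k) M z = y → ‖V' μ (z + unitVec (fine (L ^ m * L ^ k) M) κ) - V' μ z‖ ≤ b)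
    (a' : Fin (d + 1) → Fin (L ^ m * L ^ k)) (ν : Fin (d + 1)) (l j : ι) :
    |(cvaStair M (L ^ m * L ^ k) (fun μ b => cvT e V' μ b.1) y a' ν -
        cvaStair M (L ^ m * L ^ k) (fun μ b => cvT e V' μ b.1) y (fun i => ⟨L ^ m * ((a' i : ℕ) / L ^ m), (Nat.mul_div_le _ _).trans_lt (a' i).isLt⟩) ν) l j| ≤
      @basisConst ι _ (Matrix mm mm ℂ) Matrix.frobeniusNormedAddCommGroup Matrix.frobeniusNormedSpace e * (2 * Real.sqrt (Fintype.card mm)) *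
        (Real.sqrt (Fintype.card mm) * ((d + 1) * (d * (((L ^ m * L ^ k : ℕ) : ℝ) * ((L ^ m : ℕ) * b)) + ((1 + ρ) ^ (L ^ m) - 1)))) := by
  have hLm : 0 < L ^ m := pow_pos (Nat.pos_of_ne_zero (NeZero.ne L)) m
  rw [show (fun μ (b : Tor (fine (L ^ m * L ^ k) M) × Fin (d + 1)) => cvT e V' μ b.1) =
      (fun μ q => coordMat e (ContinuousLinearMap.mulLeftRight ℝ (Matrix mm mm ℂ) ((fun μ (q : Tor (fine (L ^ m * L ^ k) M) × Fin (d + 1)) => V' μ q.1) μ q)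
        ((fun μ (q : Tor (fine (L ^ m * L ^ k) M) × Fin (d + 1)) => V' μ q.1) μ q)ᴴ)) from rfl,
    cvaStair_conj, cvaStair_conj, Matrix.sub_apply]
  have hu1 := holStair_unitary M (U := fun μ (q : Tor (fine (L ^ m * L ^ k) M) × Fin (d + 1)) => V' μ q.1) (fun μ p => hV μ p.1) y a' ν
  have hu2 := holStair_unitary M (U := fun μ (q : Tor (fine (L ^ m * L ^ k) M) × Fin (d + 1)) => V' μ q.1) (fun μ p => hV μ p.1) y
    (fun i => ⟨L ^ m * ((a' i : ℕ) / L ^ m), (Nat.mul_div_le _ _).trans_lt (a' i).isLt⟩) ν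
  have h := uN_abs_coordMat_conj_sub_conj_entry_le_op e hu2 hu1 l j
  rw [← Matrix.sub_apply]
  refine h.trans (mul_le_mul_of_nonneg_left (mul_le_mul_of_nonneg_left ?_ (Real.sqrt_nonneg _)) (mul_nonneg (@basisConst_nonneg ι _ (Matrix mm mm ℂ) Matrix.frobeniusNormedAddCommGroup Matrix.frobeniusNormedSpace e) (by positivity)))
  have hst := norm_holStair_sub_holStair_le M (L ^ m * L ^ k) V' hV y hρ hb hρy hby a' (fun i => ⟨L ^ m * ((a' i : ℕ) / L ^ m), (Nat.mul_div_le _ _).trans_lt (a' i).isLt⟩)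
    (fun i => Nat.mul_div_le _ _) (K := L ^ m) (fun i => by show (a' i : ℕ) - L ^ m * ((a' i : ℕ) / L ^ m) ≤ L ^ m; rw [← Nat.mod_def]; exact (Nat.mod_lt _ hLm).le) ν
  exact_mod_cast hst

end Pair

end Summit.QuantumFields.YangMills.BalabanUVNodes.N15.CovAvg

end
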